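import Summits.Schanuel.Schanuel.Theorems.SoloInformedAE1tauGelfondInput
import Summits.Schanuel.Schanuel.Theorems.SoloInformedAE1tauEventually

/-!
# Theorem AE-1τ: `ν > β + 4(1 − σ − τ)` is an exponent — conditionally on [Roy2010, Cor 3.2]

Soloist file (informed mode, seat `solo-Schanuel-informed`, s180).  The kernel form of the
seat's THEOREM AE-1τ (`paper/AE-note.md` §9, `η = 0` form) on the node
`RoyAdditiveDirichletExponent` ([cite: Roy2010, Thm 1.1]; Roy's question there is whether
every `ν > 1 + β − σ − τ` is an exponent), CONDITIONAL on D. Roy's pointwise transfer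
estimate [cite: Roy2010, Cor 3.2] carried as the displayed hypothesis `(hR1 : cor_3_2)`
(a typed named fact of the Literature tree, not proved there):

  for `ξ ∈ ℂ` transcendental, `β > 1`, `0 < σ`, `0 < τ`, `σ + τ < 1`: every
  `ν > β + 4(1 − σ − τ)` lies in `royAdditiveSVEExponents ξ β σ τ`.

Compared with THEOREM AE-1 (`soloT1_Ioi_subset_royAdditiveSVEExponents`, threshold
`4 + β − 4σ`, unconditional, derivatives unused) the derivatives now count with the same
weight as the points: the primitive gcd `Q` of `P, P^{[1]}, …, P^{[t-1]}` (`t ≍ n^τ`) is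
small at most points `iξ` by [Roy2010, Cor 3.2] (`soloPT_few_bad_points_card`), and its
radical has degree `≤ n/t` and logarithmic Mahler measure `≤ 2n^β/t` (`soloDG_*`), which
divides the degree and height budgets of THEOREM C (`soloGS_structured_roots`) and of the
Gel'fond input (`soloGG_gelfond_input`) by `t`.  Gel'fond's criterion
(`Literature.NumberTheory.Transcendental.gelfond_criterion_not_small_values`) is run with
`(N+1)^{e₁}`, `(N+1)^{e₂}`, `e₁ = 1 − σ − τ + κ`, `e₂ = β − σ − τ + κ`, `κ = s₀/4`,
`s₀ = ν − β − 2 + 3σ + 2τ > 0`; the binding constraint `ν > β + 4(1 − σ − τ)` is THEOREM C's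
budget (`soloTT_condD'`).  The threshold improves the one-point Gel'fond ceiling `1 + β` iff
`σ + τ > 3/4`, and tends to Roy's conjectured `1 + β − σ − τ → β` as `σ + τ → 1`.

What this is NOT.  Conditional on [cite: Roy2010, Cor 3.2] as displayed (the case `τ = 0`,
THEOREM AE-1, is unconditional); not the node `RoyAdditiveDirichletExponent`, whose window
`(1 + β − σ − τ, β + 4(1 − σ − τ)]` stays open; and nothing here bears on
`Literature.Periods.SchanuelConjecture` (the seat's verdict, no path, is unchanged).  Tree
files and Mathlib only; no definitions; axioms the standard three.
-/

namespace Summit.Schanuel.Schanuel.Theorems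

open Polynomial Finset Filter
open Literature.NumberTheory.Transcendental.Roy2010 (cor_3_2)

/-- **THEOREM AE-1τ (kernel form, conditional on [Roy2010, Cor 3.2]).**  For `ξ`
transcendental, `β > 1`, `0 < σ`, `0 < τ`, `σ + τ < 1`: every `ν > β + 4(1 − σ − τ)` is an
exponent of Roy's additive small value estimate at the points `iξ` with derivatives of order
`≤ n^τ`, i.e. `Set.Ioi (β + 4(1 - σ - τ)) ⊆ royAdditiveSVEExponents ξ β σ τ`. -/
theorem soloAT_Ioi_subset_royAdditiveSVEExponents (hR1 : cor_3_2) {ξ : ℂ}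
    (hξ : Transcendental ℚ ξ) {β σ τ : ℝ} (hβ : 1 < β) (hσ0 : 0 < σ) (hτ0 : 0 < τ)
    (hστ : σ + τ < 1) :
    Set.Ioi (β + 4 * (1 - σ - τ)) ⊆ royAdditiveSVEExponents ξ β σ τ := by
  intro ν hν
  rw [Set.mem_Ioi] at hν
  by_contra hcon
  have hev : ∀ᶠ n : ℕ in atTop, (RoyAdditiveSmall ξ β σ τ ν n).Nonempty :=
    (Filter.not_frequently.mp hcon).mono fun n hn => not_not.mp hn
  have hξ0 : ξ ≠ 0 := by
    intro h
    apply hξ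
    rw [h]
    exact isAlgebraic_zero
  have hξpos : 0 < ‖ξ‖ := norm_pos_iff.mpr hξ0
  have hσ1 : σ < 1 := by linarith
  have hν1 : 1 < ν := by nlinarith
  -- the constant `c₁` of the served-set lemma
  set c₁ : ℝ := max 0 (Real.log (2 / ‖ξ‖)) with hc₁
  have hc : Real.exp (-c₁) ≤ min 1 (‖ξ‖ / 2) := by
    refine le_min ?_ ?_
    · rw [Real.exp_le_one_iff]
      linarith [le_max_left 0 (Real.log (2 / ‖ξ‖))]
    · have h2 : 0 < 2 / ‖ξ‖ := by positivity
      calc Real.exp (-c₁) ≤ Real.exp (-Real.log (2 / ‖ξ‖)) :=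
            Real.exp_le_exp.mpr (by linarith [le_max_right 0 (Real.log (2 / ‖ξ‖))])
        _ = ‖ξ‖ / 2 := by rw [Real.exp_neg, Real.exp_log h2, inv_div]
  -- exponents of the comparison sequences
  set s₀ : ℝ := ν - β - 2 + 3 * σ + 2 * τ with hs₀
  have hs₀0 : 0 < s₀ := by rw [hs₀]; linarith
  set κ : ℝ := s₀ / 4 with hκ
  have hκ0 : 0 < κ := by rw [hκ]; linarith
  set δ : ℝ := min (s₀ / 4) ((ν - 1) / 2) with hδ
  have hδ0 : 0 < δ := lt_min (by linarith) (by linarith)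
  have hδ1 : δ ≤ s₀ / 4 := min_le_left _ _
  have hδ2 : δ ≤ (ν - 1) / 2 := min_le_right _ _
  set ν' : ℝ := ν - δ with hν'
  have hν'1 : 1 < ν' := by rw [hν']; linarith
  have hν'ν : ν' < ν := by rw [hν']; linarith
  set e₁ : ℝ := 1 - σ - τ + κ with he₁
  set e₂ : ℝ := β - σ - τ + κ with he₂
  have he₁0 : 0 < e₁ := by rw [he₁]; linarith
  have he₂0 : 0 < e₂ := by rw [he₂]; linarith
  have he12 : e₁ ≤ e₂ := by rw [he₁, he₂]; linarith
  have hE : e₁ + e₂ < ν' + σ - 1 := by rw [he₁, he₂, hν', hκ]; linarith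
  set a : ℝ := (2 : ℝ) ^ e₂ + 1 with ha_def
  have h2e₂ : 0 < (2 : ℝ) ^ e₂ := by positivity
  have ha1 : 1 < a := by linarith
  have ha0 : 0 < a := by linarith
  have h2e₁ : (2 : ℝ) ^ e₁ ≤ (2 : ℝ) ^ e₂ :=
    Real.rpow_le_rpow_of_exponent_le (by norm_num) he12
  -- all eventual conditions at once
  have hall := hev.and ((eventually_ge_atTop 1).and ((soloT1_floor hσ0).and
    ((soloTT_tfloor hτ0).and ((soloTT_Kt hσ0 hτ0 hστ).and
    ((soloT1_condA hν1 (2 * c₁)).and ((soloT1_condB hξ0 hσ0 (ν := ν') (by linarith)).and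
    ((soloT1_condC ξ hσ0 hν'1).and ((eventually_const_mul_rpow_le_rpow hν'ν 4).and
    ((soloTT_condA' hξ0 hσ0 hσ1 (τ := τ) (ν := ν) (by linarith) hν1).and
    ((soloTT_condB' hβ.le hσ0 hτ0 (ν := ν) (by linarith)).and
    ((soloTT_condD' hβ.le hσ0 hτ0 hν).and
    ((soloTT_condE' ξ hσ0 hτ0 (β := β) (ν := ν) (by linarith) (by linarith)).and
    ((soloTT_condF' hσ0 hτ0 hστ (e₁ := e₁) (by rw [he₁]; linarith)).and
    ((soloTT_condG' (β := β) hσ0 hσ1 hτ0 hστ hκ0 (e₂ := e₂) (by rw [he₂]; linarith)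
      (by rw [he₂]; linarith)).and
    (soloT1_condH (ν := ν') hσ0 he₁0.le he₂0.le hE ha0)))))))))))))))
  obtain ⟨N₀, hN₀⟩ := Filter.eventually_atTop.mp hall
  -- the Gel'fond inputs `Q n`, `n ≥ N₀` (junk `1` below `N₀`)
  have hex : ∀ n : ℕ, ∃ Q : ℤ[X], N₀ ≤ n →
      Q ≠ 0 ∧ (Q.natDegree : ℝ) ≤
          20 * ((n : ℝ) / ((⌊(n : ℝ) ^ τ / 2⌋₊ + 1 : ℕ) : ℝ)) / ⌊(n : ℝ) ^ σ⌋₊ ∧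
        Q.gelfondType ≤
          20 * ((n : ℝ) / ((⌊(n : ℝ) ^ τ / 2⌋₊ + 1 : ℕ) : ℝ)) / ⌊(n : ℝ) ^ σ⌋₊ *
              (2 + Real.log ⌊(n : ℝ) ^ σ⌋₊) +
            20 * (2 * (n : ℝ) ^ β / ((⌊(n : ℝ) ^ τ / 2⌋₊ + 1 : ℕ) : ℝ)) / ⌊(n : ℝ) ^ σ⌋₊ ∧
        ‖aeval ξ Q‖ ≤
          Real.exp (-((n : ℝ) ^ ν / 2 * ⌊(n : ℝ) ^ σ⌋₊ / (400 * n) / 2)) := by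
    intro n
    by_cases h : N₀ ≤ n
    · obtain ⟨hne, hn1, ⟨hn1', hK, hKle, hKge⟩, ⟨ht2, htτ, -, -⟩, hKt, hcA, ⟨hcB1, hcB2⟩,
        hcC, hcmp, hA', hB', hD', hE', -, -, -⟩ := hN₀ n h
      have hn0 : (0 : ℝ) < n := by exact_mod_cast hn1
      obtain ⟨hc1, hc2, -⟩ := soloTT_cmp (ν := ν) hn0 (Nat.cast_nonneg ⌊(n : ℝ) ^ σ⌋₊) hcmp
      have h₁ : 2 * c₁ * n ≤ (n : ℝ) ^ ν / 2 := by linarith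
      have hexp : Real.exp (-((n : ℝ) ^ ν / 2 * ⌊(n : ℝ) ^ σ⌋₊ / (400 * n))) ≤
          Real.exp (-((n : ℝ) ^ ν' * ⌊(n : ℝ) ^ σ⌋₊ / (200 * n))) :=
        Real.exp_le_exp.mpr (by linarith)
      have h₂ : Real.exp (-((n : ℝ) ^ ν / 2 * ⌊(n : ℝ) ^ σ⌋₊ / (400 * n))) ≤ 1 / 2 :=
        hexp.trans hcB1
      have h₃ : 4 * Real.exp (-((n : ℝ) ^ ν / 2 * ⌊(n : ℝ) ^ σ⌋₊ / (400 * n))) ≤ ‖ξ‖ := by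
        linarith
      have h₄ : Real.log (8 * (⌊(n : ℝ) ^ σ⌋₊ * ‖ξ‖ + 1)) ≤
          (n : ℝ) ^ ν / 2 * ⌊(n : ℝ) ^ σ⌋₊ / (800 * n) := hcC.trans hc2
      obtain ⟨Q, hQ⟩ := soloAT_gelfond_input hR1 hξ hβ.le hn1 hK hKle ht2 htτ hKt hc hA'
        hB' h₁ h₂ h₃ h₄ hD' hE' hne.some_mem
      exact ⟨Q, fun _ => hQ⟩
    · exact ⟨1, fun h' => absurd h' h⟩
  choose Q hQ using hex
  -- Gel'fond's criterion with `δ_N = (N+1)^{e₁}`, `σ_N = (N+1)^{e₂}`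
  obtain ⟨hδm, hδ0', -, hδr⟩ := soloT1_seq he₁0
  obtain ⟨hσm, hσ0', hσt, hσr⟩ := soloT1_seq he₂0
  have hδa : ∀ N : ℕ, (((N + 1 : ℕ) : ℝ) + 1) ^ e₁ ≤ a * (((N : ℝ) + 1) ^ e₁) := fun N => by
    have hp : 0 < ((N : ℝ) + 1) ^ e₁ := hδ0' N
    calc (((N + 1 : ℕ) : ℝ) + 1) ^ e₁ ≤ (2 : ℝ) ^ e₁ * ((N : ℝ) + 1) ^ e₁ := hδr N
      _ ≤ a * ((N : ℝ) + 1) ^ e₁ := by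
          apply mul_le_mul_of_nonneg_right _ hp.le
          linarith
  have hσa : ∀ N : ℕ, (((N + 1 : ℕ) : ℝ) + 1) ^ e₂ < a * (((N : ℝ) + 1) ^ e₂) := fun N => by
    have hp : 0 < ((N : ℝ) + 1) ^ e₂ := hσ0' N
    calc (((N + 1 : ℕ) : ℝ) + 1) ^ e₂ ≤ (2 : ℝ) ^ e₂ * ((N : ℝ) + 1) ^ e₂ := hσr N
      _ < a * ((N : ℝ) + 1) ^ e₂ := by
          apply mul_lt_mul_of_pos_right _ hp
          linarith
  have hQcrit : ∀ N, N₀ ≤ N → Q N ≠ 0 ∧ ((Q N).natDegree : ℝ) < ((N : ℝ) + 1) ^ e₁ ∧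
      (Q N).gelfondType < ((N : ℝ) + 1) ^ e₂ := fun N hN => by
    obtain ⟨hQ0, hQd, hQt, -⟩ := hQ N hN
    obtain ⟨-, -, -, -, -, -, -, -, -, -, -, -, -, hF, hG, -⟩ := hN₀ N hN
    exact ⟨hQ0, hQd.trans_lt hF, hQt.trans_lt hG⟩
  obtain ⟨N, hNN₀, hlow⟩ :=
    Literature.NumberTheory.Transcendental.gelfond_criterion_not_small_values hξ a ha1
      (fun N : ℕ => ((N : ℝ) + 1) ^ e₁) (fun N : ℕ => ((N : ℝ) + 1) ^ e₂) hδm hσm hδ0' hσ0'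
      hσt hδa hσa Q N₀ hQcrit
  -- compare the two bounds at this `N`
  obtain ⟨-, -, -, hup⟩ := hQ N hNN₀
  obtain ⟨-, hN1, -, -, -, -, -, -, hcmp, -, -, -, -, -, -, hH⟩ := hN₀ N hNN₀
  have hN0 : (0 : ℝ) < N := by exact_mod_cast hN1
  obtain ⟨-, -, hc3⟩ := soloTT_cmp (ν := ν) hN0 (Nat.cast_nonneg ⌊(N : ℝ) ^ σ⌋₊) hcmp
  have hfin := Real.exp_le_exp.mp (hlow.trans hup)
  linarith

end Summit.Schanuel.Schanuel.Theorems
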